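import Summits.Ventures.Crystal3D.Theorems.StickyWulffConstantCoaxialWallLawBarlowSiteReadingsMirror
import Summits.Ventures.Crystal3D.Theorems.StickyWulffConstantTextureLiminfTexShadowCertificateDefs
import Literature.MathematicalPhysics.StatisticalMechanics.BarlowCovering
import HarnessLib

/-!
# The unit sphere of a ball INSIDE a clamped Barlow plate: all twelve stacking neighbours present, nothing else (F_layer L2/L3 brick, part 3)

HONEST FRAMING. Venture `Summits/Ventures/Crystal3D` (cell `crystal3d-full`); helper for the crux `CoaxialWallLaw` (stmt-Ventures-19481)
in its role as owner of lane T's debt T-F2 / F_layer (cf-p1 (lxxiii)/(lxxx)/(lxxxiii)).  Census-free, standard axioms; nothing about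
the crux is claimed; F-C1 not moved.  This supplies, from CELL-type hypotheses, the two window hypotheses of `…BarlowSiteReadings`
(`hnb`: the twelve stacking neighbours of the site are occupied; `hX`: the occupied unit sphere lies on the stacking) — for ANY moved
Barlow stacking `stacking L s σ` (lane T's presentation) and any point `q` whose radius-`2` ball lies in a region `W` on which the
configuration `X` CONTAINS the plate: then (covering radius `√(1/2) < 1` of a Barlow stacking, Literature `…BarlowCovering`, + `1`-separation)
every ball of `X` at distance `1` from `q` is a plate site, and every plate site at distance `1` from `q` is a ball of `X`.

* `exists_site_near_of_stacking` — every point is within `√(1/2)` of a site of `stacking L s σ`;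
* **`barlowPlate_unitSphere`** — the pair (`hnb`, `hX`) above;
WHAT THIS IS NOT: no reading, no walker; F-C1 not moved.
-/

noncomputable section

namespace Summit.Ventures.Crystal3D.Theorems

open Summit.Ventures.Crystal3D Finset
open Literature.MathematicalPhysics.StatisticalMechanics (barlowPos barlowStacking IsHaggSeq barlowPos_mem
  exists_barlowPos_slab_dist_sq_le_half)
open Summit.Ventures.Crystal3D.Cruxes.TextureLiminf.TexShadow (E3 stacking)
open scoped InnerProductSpace

/-- **Covering radius of a moved Barlow stacking**: every point of space is within `√(1/2)` of a site of `stacking L s σ`. -/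
theorem exists_site_near_of_stacking (σ : ℤ → ℤ) (L : E3 ≃ₗᵢ[ℝ] E3) (s x : E3) :
    ∃ p ∈ stacking L s σ, dist x p ^ 2 ≤ 1 / 2 := by
  have hB : (0 : ℝ) < Real.sqrt (2 / 3) := Real.sqrt_pos.2 (by norm_num)
  set y : E3 := L.symm (x - s) with hy
  obtain ⟨k₀, hk₀_def⟩ : ∃ k₀ : ℤ, k₀ = ⌊y 2 / Real.sqrt (2 / 3)⌋ := ⟨_, rfl⟩
  have hk₀ : (k₀ : ℝ) * Real.sqrt (2 / 3) ≤ y 2 := by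
    have := Int.floor_le (y 2 / Real.sqrt (2 / 3))
    rw [le_div_iff₀ hB, ← hk₀_def] at this
    exact this
  have hk₀₁ : y 2 ≤ ((k₀ + 1 : ℤ) : ℝ) * Real.sqrt (2 / 3) := by
    have := Int.lt_floor_add_one (y 2 / Real.sqrt (2 / 3))
    rw [div_lt_iff₀ hB, ← hk₀_def] at this
    push_cast
    exact this.le
  obtain ⟨k', i, j, -, -, hd⟩ := exists_barlowPos_slab_dist_sq_le_half σ (by omega : k₀ ≤ k₀ + 1) y hk₀ hk₀₁
  refine ⟨L (barlowPos 1 (Real.sqrt (2 / 3)) σ k' i j) + s, ⟨_, barlowPos_mem k' i j, rfl⟩, ?_⟩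
  have he : dist x (L (barlowPos 1 (Real.sqrt (2 / 3)) σ k' i j) + s) = dist y (barlowPos 1 (Real.sqrt (2 / 3)) σ k' i j) := by
    have h1 : dist x (L (barlowPos 1 (Real.sqrt (2 / 3)) σ k' i j) + s) =
        dist (x - s + s) (L (barlowPos 1 (Real.sqrt (2 / 3)) σ k' i j) + s) := by rw [sub_add_cancel]
    rw [h1, dist_add_right, hy, ← L.symm.dist_map (x - s), LinearIsometryEquiv.symm_apply_apply]
  rw [he]; exact hd

/-- **The unit sphere of a ball inside a clamped Barlow plate.**  If `X` is `1`-separated and CONTAINS every site of `stacking L s σ`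
lying in the region `W`, and the radius-`2` ball about `q` lies in `W`, then: (i) every site at distance `1` from `q` is in `X`;
(ii) every ball of `X` at distance `1` from `q` is a site.  (The hypotheses `hnb`, `hX` of `…BarlowSiteReadings`, transported.) -/
theorem barlowPlate_unitSphere (σ : ℤ → ℤ) (L : E3 ≃ₗᵢ[ℝ] E3) (s : E3) {X : Finset E3}
    (hsep : ∀ p ∈ X, ∀ p' ∈ X, p ≠ p' → 1 ≤ dist p p') {W : Set E3}
    (hplate : ∀ p ∈ stacking L s σ, p ∈ W → p ∈ X) {q : E3} (hW : ∀ x, dist q x ≤ 2 → x ∈ W) :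
    (∀ x ∈ stacking L s σ, dist q x = 1 → x ∈ X) ∧ (∀ x ∈ X, dist q x = 1 → x ∈ stacking L s σ) := by
  refine ⟨fun x hx hd => hplate x hx (hW x (by rw [hd]; norm_num)), fun x hx hd => ?_⟩
  obtain ⟨p, hp, hdp⟩ := exists_site_near_of_stacking σ L s x
  have hdp' : dist x p < 1 := by
    have h0 : 0 ≤ dist x p := dist_nonneg
    nlinarith
  have hpW : p ∈ W := by
    refine hW p ?_
    have := dist_triangle q x p
    linarith
  have hpX : p ∈ X := hplate p hp hpW
  by_cases hxp : x = p
  · rw [hxp]; exact hp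
  · have := hsep x hx p hpX hxp
    linarith

end Summit.Ventures.Crystal3D.Theorems

end
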